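/-
Copyright: the b2b-balaban cell (near-miss cell 7), T⁴-continuum CRUX team (coordinator ruling e34b3e0c item (2)),
seat t4-ne7b-formalise-leaf-05 (gen 28). Released under the licence of the surrounding project.
-/
import Literature.MathematicalPhysics.QuantumFieldTheory.Sweep1

/-!
# Torn pure gauges on `ℤ^d`: the lattice vortex-sheet ansatz (toolkit for the witness W-hol)
# (route NE7b R-H ∕ C-RH°, `t4/ROUTES-NE7b.md` v7 Δv7 item 1 «Witness W-hol»; §4∕§6 «[explicit construction]: W-hol»)

Cell `pub-balaban`, sub-cell `t4`, spine estimate NE7b (node U5c), candidate route R-H. ROUTES-NE7b v7's witness W-hol (a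
flat exterior around a HOLLOW healing domain whose Type-II holonomy forces flux in every filling — the negative half of the
decision (BOX)) is, on the lattice, the textbook thin vortex sheet: «a singular gauge transformation, discontinuous on a
3-volume `V₃` bounded by a surface `S`, creates a surface of magnetic flux on `S`; a holonomy along a loop linked to `S` is
changed». THIS FILE is the group-level toolkit, for ANY dimension `d` and ANY group `G` (no commutativity anywhere):

* `tornGauge lam S` — the pure gauge `(x, μ) ↦ lam x · (lam (x + e_μ))⁻¹` of a site function `lam : ℤ^d → G`, KEPT in the
  directions `μ ∈ S` and set to `1` in the others (`S = univ`: the gauge transform of `U ≡ 1`);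
* straight lines (`Sweep1`'s `ZdGaugeConfig.line`) TELESCOPE in kept directions (`line_tornGauge_of_mem`) and are `1` in
  torn ones; plaquettes (`ZdGaugeConfig.plaquette`) are `1` in kept × kept planes (`plaquette_tornGauge_of_mem_of_mem`, a
  pure-gauge plaquette) and in torn × torn planes, and in a MIXED plane they are an explicit four-letter word in `lam`
  (`plaquette_tornGauge_of_not_mem_of_mem` ∕ `_of_mem_of_not_mem`) which is `1` as soon as `lam` is `e_i`-periodic along the
  `e_j`-edge or `e_j`-periodic along the `e_i`-edge (**`plaquette_tornGauge_eq_one_of_periodic_i ∕ _j`** — the curvature of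
  a torn gauge lives where `lam` jumps across BOTH edges); rectangles (`ZdGaugeConfig.rectangle`) are `1` in kept × kept
  planes and the telescoped four-corner word in a mixed plane (`rectangle_tornGauge_of_not_mem_of_mem`).

The `ℤ⁴` witness itself (hollow hole, exact flatness, Type-II holonomy, forced flux via leaf-01's (NAS)∕(FF)) is
`HollowForcedFluxWitness`. HONEST FRAMING. Law-free lattice gauge algebra on ONE configuration; no measure, nothing of
[Bałaban 1983–89] asserted or cited; moves NO grade. NE7b (`T4WeightBudget.RelWeightBound`) NOT PRINTED, NOT PROVED; spine
PROVED 0∕9; rung (B)+1 on a FINITE torus T⁴ — NOT infinite volume, NOT the mass gap, NOT Clay. HONEST DEPENDENCY: continuum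
YM on T⁴ ⇐ BetaPertH ∧ nine spine estimates (0/9 proved); BetaPertH ⇐ (D1) ∧ (D4) ∧ CAP+tail; G-an2-4 gates asym, D1 and
NE2/3/4. POLICY: crux-route work under `Spine/NE7b/` (ROUTES v7 §6's named item W-hol; coordinator FREEZE (0) respected: not a
`T4Continuum/Support` leaf); one concrete definition (`tornGauge`), no `Prop`-valued definition, no `[cite:]`.
-/

set_option autoImplicit false

namespace Summit.QuantumFields.BalabanUV.T4Continuum.NE7b.TornPureGauge

noncomputable section

open Literature.MathematicalPhysics.QuantumFieldTheory (ZdGaugeConfig)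

variable {d : ℕ} {G : Type*} [Group G]

/-- The **torn pure gauge** of a site function `lam`: the bond variable `lam x · (lam (x + e_μ))⁻¹` in the KEPT directions
`μ ∈ S`, and `1` in the torn ones. (For `S = univ` this is the gauge transform of the trivial configuration.) -/
def tornGauge (lam : (Fin d → ℤ) → G) (S : Finset (Fin d)) : ZdGaugeConfig d G :=
  fun b => if b.2 ∈ S then lam b.1 * (lam (b.1 + Pi.single b.2 1))⁻¹ else 1

variable (lam : (Fin d → ℤ) → G) (S : Finset (Fin d))

/-- A kept bond carries `lam x · (lam (x + e_μ))⁻¹`. -/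
@[simp] theorem tornGauge_apply_of_mem {x : Fin d → ℤ} {μ : Fin d} (h : μ ∈ S) :
    tornGauge lam S (x, μ) = lam x * (lam (x + Pi.single μ 1))⁻¹ := if_pos h

/-- A torn bond carries `1`. -/
@[simp] theorem tornGauge_apply_of_not_mem {x : Fin d → ℤ} {μ : Fin d} (h : μ ∉ S) :
    tornGauge lam S (x, μ) = 1 := if_neg h

/-- `(y + e_k) + t e_k = y + (t + 1) e_k`. -/
theorem add_single_one_add_single (y : Fin d → ℤ) (k : Fin d) (t : ℕ) :
    y + Pi.single k (1 : ℤ) + Pi.single k (t : ℤ) = y + Pi.single k ((t + 1 : ℕ) : ℤ) := by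
  rw [add_assoc, ← Pi.single_add]
  congr 2
  omega

/-- `(y + t e_k) + e_k = y + (t + 1) e_k`. -/
theorem add_single_add_single_one (y : Fin d → ℤ) (k : Fin d) (t : ℕ) :
    y + Pi.single k (t : ℤ) + Pi.single k (1 : ℤ) = y + Pi.single k ((t + 1 : ℕ) : ℤ) := by
  rw [add_assoc, ← Pi.single_add, Nat.cast_succ]

/-- In a TORN direction every straight line has holonomy `1`. -/
theorem line_tornGauge_of_not_mem {k : Fin d} (hk : k ∉ S) :
    ∀ (n : ℕ) (y : Fin d → ℤ), ZdGaugeConfig.line (tornGauge lam S) k n y = 1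
  | 0, _ => rfl
  | n + 1, y => by
    rw [ZdGaugeConfig.line, tornGauge_apply_of_not_mem lam S hk, one_mul, line_tornGauge_of_not_mem hk n]

/-- In a KEPT direction straight lines TELESCOPE: `V([y, y + n e_k]) = lam y · (lam (y + n e_k))⁻¹` (any group). -/
theorem line_tornGauge_of_mem {k : Fin d} (hk : k ∈ S) :
    ∀ (n : ℕ) (y : Fin d → ℤ),
      ZdGaugeConfig.line (tornGauge lam S) k n y = lam y * (lam (y + Pi.single k (n : ℤ)))⁻¹
  | 0, y => by simp [ZdGaugeConfig.line]
  | n + 1, y => by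
    rw [ZdGaugeConfig.line, tornGauge_apply_of_mem lam S hk, line_tornGauge_of_mem hk n, add_single_one_add_single,
      mul_assoc, inv_mul_cancel_left]

/-- KEPT × KEPT plane: the plaquette is a pure-gauge plaquette, `= 1` (no commutativity needed). -/
theorem plaquette_tornGauge_of_mem_of_mem {i j : Fin d} (hi : i ∈ S) (hj : j ∈ S) (x : Fin d → ℤ) :
    ZdGaugeConfig.plaquette (tornGauge lam S) x i j = 1 := by
  simp only [ZdGaugeConfig.plaquette, tornGauge_apply_of_mem lam S hi, tornGauge_apply_of_mem lam S hj]
  rw [add_right_comm x (Pi.single j 1) (Pi.single i 1)]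
  group

/-- TORN × TORN plane: all four bonds are `1`. -/
theorem plaquette_tornGauge_of_not_mem_of_not_mem {i j : Fin d} (hi : i ∉ S) (hj : j ∉ S) (x : Fin d → ℤ) :
    ZdGaugeConfig.plaquette (tornGauge lam S) x i j = 1 := by
  simp [ZdGaugeConfig.plaquette, tornGauge_apply_of_not_mem lam S hi, tornGauge_apply_of_not_mem lam S hj]

/-- MIXED plane, `i` torn and `j` kept: `V(∂p_{ij}(x)) = lam (x+e_i) · lam (x+e_i+e_j)⁻¹ · lam (x+e_j) · (lam x)⁻¹`. -/
theorem plaquette_tornGauge_of_not_mem_of_mem {i j : Fin d} (hi : i ∉ S) (hj : j ∈ S) (x : Fin d → ℤ) :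
    ZdGaugeConfig.plaquette (tornGauge lam S) x i j =
      lam (x + Pi.single i 1) * (lam (x + Pi.single i 1 + Pi.single j 1))⁻¹ * lam (x + Pi.single j 1) * (lam x)⁻¹ := by
  simp only [ZdGaugeConfig.plaquette, tornGauge_apply_of_not_mem lam S hi, tornGauge_apply_of_mem lam S hj]
  group

/-- MIXED plane, `i` kept and `j` torn: `V(∂p_{ij}(x)) = lam x · lam (x+e_i)⁻¹ · lam (x+e_j+e_i) · (lam (x+e_j))⁻¹`. -/
theorem plaquette_tornGauge_of_mem_of_not_mem {i j : Fin d} (hi : i ∈ S) (hj : j ∉ S) (x : Fin d → ℤ) :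
    ZdGaugeConfig.plaquette (tornGauge lam S) x i j =
      lam x * (lam (x + Pi.single i 1))⁻¹ * lam (x + Pi.single j 1 + Pi.single i 1) * (lam (x + Pi.single j 1))⁻¹ := by
  simp only [ZdGaugeConfig.plaquette, tornGauge_apply_of_mem lam S hi, tornGauge_apply_of_not_mem lam S hj]
  group

/-- **VANISHING CRITERION (i)**: if `lam` is `e_i`-periodic at `x` and at `x + e_j`, the plaquette `∂p_{ij}(x)` of the torn
gauge is `1` — whatever the kept set. -/
theorem plaquette_tornGauge_eq_one_of_periodic_i (x : Fin d → ℤ) (i j : Fin d)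
    (h1 : lam (x + Pi.single i 1) = lam x) (h2 : lam (x + Pi.single i 1 + Pi.single j 1) = lam (x + Pi.single j 1)) :
    ZdGaugeConfig.plaquette (tornGauge lam S) x i j = 1 := by
  by_cases hi : i ∈ S <;> by_cases hj : j ∈ S
  · exact plaquette_tornGauge_of_mem_of_mem lam S hi hj x
  · rw [plaquette_tornGauge_of_mem_of_not_mem lam S hi hj, add_right_comm x (Pi.single j 1) (Pi.single i 1), h2, h1]
    group
  · rw [plaquette_tornGauge_of_not_mem_of_mem lam S hi hj, h2, h1]
    group
  · exact plaquette_tornGauge_of_not_mem_of_not_mem lam S hi hj x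

/-- **VANISHING CRITERION (j)**: if `lam` is `e_j`-periodic at `x` and at `x + e_i`, the plaquette `∂p_{ij}(x)` is `1`. -/
theorem plaquette_tornGauge_eq_one_of_periodic_j (x : Fin d → ℤ) (i j : Fin d)
    (h1 : lam (x + Pi.single j 1) = lam x) (h2 : lam (x + Pi.single i 1 + Pi.single j 1) = lam (x + Pi.single i 1)) :
    ZdGaugeConfig.plaquette (tornGauge lam S) x i j = 1 := by
  by_cases hi : i ∈ S <;> by_cases hj : j ∈ S
  · exact plaquette_tornGauge_of_mem_of_mem lam S hi hj x
  · rw [plaquette_tornGauge_of_mem_of_not_mem lam S hi hj, add_right_comm x (Pi.single j 1) (Pi.single i 1), h2, h1]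
    group
  · rw [plaquette_tornGauge_of_not_mem_of_mem lam S hi hj, h2, h1]
    group
  · exact plaquette_tornGauge_of_not_mem_of_not_mem lam S hi hj x

/-- KEPT × KEPT rectangles are pure-gauge Wilson loops: holonomy `1`. -/
theorem rectangle_tornGauge_of_mem_of_mem {i j : Fin d} (hi : i ∈ S) (hj : j ∈ S) (x : Fin d → ℤ) (R T : ℕ) :
    ZdGaugeConfig.rectangle (tornGauge lam S) x i j R T = 1 := by
  simp only [ZdGaugeConfig.rectangle, line_tornGauge_of_mem lam S hi, line_tornGauge_of_mem lam S hj]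
  rw [add_right_comm x (Pi.single j (T : ℤ)) (Pi.single i (R : ℤ))]
  group

/-- MIXED rectangle, `i` torn and `j` kept: `V(∂R_{R,T}(x)) = lam (x+Re_i) · lam (x+Re_i+Te_j)⁻¹ · lam (x+Te_j) · (lam x)⁻¹`
— only the two kept sides contribute, and they telescope. -/
theorem rectangle_tornGauge_of_not_mem_of_mem {i j : Fin d} (hi : i ∉ S) (hj : j ∈ S) (x : Fin d → ℤ) (R T : ℕ) :
    ZdGaugeConfig.rectangle (tornGauge lam S) x i j R T =
      lam (x + Pi.single i (R : ℤ)) * (lam (x + Pi.single i (R : ℤ) + Pi.single j (T : ℤ)))⁻¹ *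
        lam (x + Pi.single j (T : ℤ)) * (lam x)⁻¹ := by
  simp only [ZdGaugeConfig.rectangle, line_tornGauge_of_not_mem lam S hi, line_tornGauge_of_mem lam S hj]
  group


end

end Summit.QuantumFields.BalabanUV.T4Continuum.NE7b.TornPureGauge
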